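import Literature.Computability.MetaComplexity.FregeThresholdFormulas
import HarnessLib

/-!
# Frege derivations for threshold formulas: zero, overflow, monotonicity

Topic `Literature/Computability/MetaComplexity`. Bounded `textbookFrege` derivations
(`TextbookFrege.BD`, one-sided sequents `⊢ Γ` read through `TextbookFrege.disjList`) about the
divide-and-conquer threshold formulas `ThrCount.thr` (`FregeThresholdFormulas.lean`), within a
parameter frame `F : ThrCount.Frame` whose tail `F.L` is appended to every sequent:

* `Frame.zeroS` — `⊢ thr G 0 s e, L` ("at least zero inputs hold");
* `Frame.overS` — `⊢ ¬ thr G k s e, L` whenever `k` exceeds the number `live n s e` of inputs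
  of the segment that are not the dead padding `⊥` (in particular "at least `n+1` of `n`" is
  refutable);
* `Frame.monoS` — **monotonicity**: from `⊢ ¬G l, G' l, L` for every input `l` of the segment,
  `⊢ ¬ thr G k s e, thr G' k s e, L` for every `k`;

each by induction on the level `e`, one halving per level, with explicit line counts `F.zl e`,
`F.ol e`, `F.ml m e` (recursions in `e` whose growth factor per level is linear in `F.K ≥ 2^E`,
hence quasi-polynomial at `E = O(log n)`).

References: S. R. Buss, *Polynomial size proofs of the propositional pigeonhole principle*,
J. Symbolic Logic 52 (1987) 916–927 (Frege proofs reason about counting formulas level by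
level); J. R. Shoenfield, *Mathematical Logic* (1967), §3.1 (the sequent rules, as bounded in
`FregeBounded.lean`). The proofs here are the evident inductions ("folklore").
-/

namespace Literature.Computability.MetaComplexity

open Complexity Complexity.PropForm TextbookFrege

namespace ThrCount

namespace Frame

variable (F : Frame)

/-! ### Line counts -/

/-- Lines of `zeroS` at level `e`. [folklore] -/
def zl : ℕ → ℕ
  | 0 => 8 + 50 * (F.M + 1) ^ 2
  | e + 1 => 2 * zl e + 260 * (F.M + 1) ^ 2

/-- Lines of `overS` at level `e`. [folklore] -/
def ol : ℕ → ℕ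
  | 0 => 8 + 50 * (F.M + 1) ^ 2
  | e + 1 => (F.K + 2) * (ol e + 60 * (F.M + 1) ^ 2 + 50)

/-- Lines of `monoS` at level `e`, from hypotheses of `m` lines. [folklore] -/
def ml (m : ℕ) : ℕ → ℕ
  | 0 => m + 8 + 50 * (F.M + 1) ^ 2
  | e + 1 => (F.K + 2) * (2 * ml m e + 500 * (F.M + 1) ^ 3)

variable {F}

/-- `zl` is at least the cost of a structural step. [folklore] -/
theorem base_le_zl (e : ℕ) : 8 + 50 * (F.M + 1) ^ 2 ≤ F.zl e := by
  cases e with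
  | zero => simp [zl]
  | succ e =>
    simp only [zl]
    have : 1 ≤ (F.M + 1) ^ 2 := Nat.one_le_pow _ _ (by omega)
    nlinarith

/-- `ol` is at least the cost of a structural step. [folklore] -/
theorem base_le_ol (e : ℕ) : 8 + 50 * (F.M + 1) ^ 2 ≤ F.ol e := by
  cases e with
  | zero => simp [ol]
  | succ e =>
    simp only [ol]
    have : 1 ≤ (F.M + 1) ^ 2 := Nat.one_le_pow _ _ (by omega)
    nlinarith

/-- `ml` is at least the cost of a structural step and of a hypothesis. [folklore] -/
theorem base_le_ml (m e : ℕ) : m + 8 + 50 * (F.M + 1) ^ 2 ≤ F.ml m e := by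
  induction e with
  | zero => simp [ml]
  | succ e ih =>
    simp only [ml]
    have h1 : (F.M + 1) ^ 2 ≤ (F.M + 1) ^ 3 := Nat.pow_le_pow_right (by omega) (by omega)
    nlinarith

/-! ### Zero -/

/-- **`⊢ thr G 0 s e, L`**: "at least `0` inputs hold" is derivable at every level.
[folklore] -/
theorem zeroS {G : ℕ → PropForm ℕ} (hG : F.Good G) :
    ∀ e, e ≤ F.E → ∀ s, BD F.D F.B (F.zl e) (disjList (thr G 0 s e :: F.L)) := by
  have hB := F.hB; have hD := F.hD; have hM := F.hM; have hp := F.hp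
  intro e
  induction e with
  | zero =>
    intro _ s
    rw [thr_zero_leaf]
    refine (topMemS (N := F.M) List.mem_cons_self (p := F.p) (fun X hX => ?_) (by omega)
      (by simp; omega) ?_).mono (by simp [zl])
    · rcases List.mem_cons.1 hX with rfl | hX
      · simp
      · exact F.hLd X hX
    · simp only [msum_cons, size]; omega
  | succ e ih =>
    intro he s
    have he' : e ≤ F.E := by omega
    have htE := tsz_mono F.σ he
    have ht2 := two_mul_tsz_le F.σ e
    set Y := thr G 0 s e with hY
    set Z := thr G 0 (s + 2 ^ e) e with hZ
    have hterms : terms G 0 s e = [conj Y Z] := by simp [terms, List.range_one, hY, hZ]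
    have sY : Y.size ≤ tsz F.σ e := hG.size_thr e 0 s
    have sZ : Z.size ≤ tsz F.σ e := hG.size_thr e 0 (s + 2 ^ e)
    have dY : Y.dd ≤ F.p - 2 := hG.dd_thr he' 0 s
    have dZ : Z.dd ≤ F.p - 2 := hG.dd_thr he' 0 (s + 2 ^ e)
    have dL : (disjList F.L).dd ≤ F.p := dd_disjList_le F.hLd
    have h1 := ih he' s
    have h2 := ih he' (s + 2 ^ e)
    rw [← hY] at h1; rw [← hZ] at h2
    have h3 : BD F.D F.B (F.zl e + F.zl e + 51) (disjList (conj Y Z :: F.L)) :=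
      consConjS h1 h2 (by omega) (by omega) (by omega)
        (by simp only [size_disjList_eq_msum]; omega)
    have hpc : ∀ X ∈ [conj Y Z] ++ F.L, X.dd ≤ F.p := by
      intro X hX
      rcases List.mem_append.1 hX with hX | hX
      · simp only [List.mem_singleton] at hX; subst hX
        exact hG.dd_terms he (by rw [hterms]; simp)
      · exact F.hLd X hX
    have h4 := nestAllS (N := F.M) [conj Y Z] (L := F.L) h3 hpc (by omega) (by simp; omega)
      (by simp only [msum_append, msum_cons, msum_nil, size]; omega)
    rw [thr_succ_of_le (Nat.zero_le _), hterms]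
    refine h4.mono ?_
    have hl1 : ([conj Y Z] : List (PropForm ℕ)).length = 1 := rfl
    rw [hl1]
    show _ ≤ 2 * F.zl e + 260 * (F.M + 1) ^ 2
    nlinarith

/-! ### Overflow -/

/-- **Overfull thresholds are refutable**: if the inputs at indices `≥ n` are the constant `⊥`
and `k > live n s e`, then `⊢ ¬ thr G k s e, L`. [folklore] -/
theorem overS {G : ℕ → PropForm ℕ} (hG : F.Good G) {n : ℕ} (hdead : ∀ l, n ≤ l → G l = const false) :
    ∀ e, e ≤ F.E → ∀ s k, live n s e < k →
      BD F.D F.B (F.ol e) (disjList (neg (thr G k s e) :: F.L)) := by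
  have hB := F.hB; have hD := F.hD; have hM := F.hM; have hp := F.hp
  have dL : (disjList F.L).dd ≤ F.p := dd_disjList_le F.hLd
  have dL1 := altDepthAux_le_dd_succ 1 (disjList F.L)
  -- the generic `⊢ ¬⊥, L`
  have hbot : BD F.D F.B (8 + 50 * (F.M + 1) ^ 2) (disjList (neg (const false) :: F.L)) := by
    refine negBotMemS (N := F.M) List.mem_cons_self (p := F.p) (fun X hX => ?_) (by omega)
      (by simp; omega) (by simp only [msum_cons, size]; omega)
    rcases List.mem_cons.1 hX with rfl | hX
    · exact F.dd_negBot_le_p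
    · exact F.hLd X hX
  intro e
  induction e with
  | zero =>
    intro _ s k hk
    simp only [live] at hk
    by_cases hs : s < n
    · rw [if_pos hs] at hk
      rw [thr_leaf_of_two_le (by omega)]
      exact hbot.mono (by simp [ol])
    · rw [if_neg hs] at hk
      rcases Nat.lt_or_ge 1 k with hk1 | hk1
      · rw [thr_leaf_of_two_le (by omega)]
        exact hbot.mono (by simp [ol])
      · obtain rfl : k = 1 := by omega
        rw [thr_one_leaf, hdead s (by omega)]
        exact hbot.mono (by simp [ol])
  | succ e ih =>
    intro he s k hk
    have he' : e ≤ F.E := by omega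
    have hKe : 2 ^ (e + 1) ≤ F.K := F.pow_le_K he
    simp only [live] at hk
    by_cases hk2 : 2 ^ (e + 1) < k
    · rw [thr_succ_of_lt hk2]
      exact hbot.mono (base_le_ol _)
    have hk2' : k ≤ 2 ^ (e + 1) := by omega
    have htE := tsz_mono F.σ he
    have ht2 := two_mul_tsz_le F.σ e
    rw [thr_succ_of_le hk2']
    -- each term overflows on one side
    have hz : ∀ z ∈ terms G k s e,
        BD F.D F.B (F.ol e + 50 * (F.M + 1) ^ 2 + 7) (disjList (neg z :: F.L)) := by
      intro z hz
      obtain ⟨a, ha, rfl⟩ := mem_terms_iff.1 hz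
      set Y := thr G a s e with hY
      set Z := thr G (k - a) (s + 2 ^ e) e with hZ
      have sY : Y.size ≤ tsz F.σ e := hG.size_thr e _ _
      have sZ : Z.size ≤ tsz F.σ e := hG.size_thr e _ _
      have dY : Y.dd ≤ F.p - 2 := hG.dd_thr he' _ _
      have dZ : Z.dd ≤ F.p - 2 := hG.dd_thr he' _ _
      have dnY : (neg Y).dd ≤ F.p := hG.dd_neg_thr he' _ _
      have dnZ : (neg Z).dd ≤ F.p := hG.dd_neg_thr he' _ _
      have hpT : ∀ X ∈ neg Y :: neg Z :: F.L, X.dd ≤ F.p := by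
        intro X hX
        simp only [List.mem_cons] at hX
        rcases hX with rfl | rfl | hX
        · exact dnY
        · exact dnZ
        · exact F.hLd X hX
      have h1 : BD F.D F.B (F.ol e + 50 * (F.M + 1) ^ 2) (disjList (neg Y :: neg Z :: F.L)) := by
        rcases Nat.lt_or_ge (live n s e) a with h | h
        · have h0 := ih he' s a h
          rw [← hY] at h0
          refine subsetN (N := F.M) h0 (fun X hX => ?_) hpT (by omega) ?_ (by simp; omega) (by simp; omega)
          · simp only [List.mem_cons] at hX ⊢; tauto
          · simp only [size_disjList_eq_msum, msum_cons, size]; omega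
        · have h' : live n (s + 2 ^ e) e < k - a := by omega
          have h0 := ih he' (s + 2 ^ e) (k - a) h'
          rw [← hZ] at h0
          refine subsetN (N := F.M) h0 (fun X hX => ?_) hpT (by omega) ?_ (by simp; omega) (by simp; omega)
          · simp only [List.mem_cons] at hX ⊢; tauto
          · simp only [size_disjList_eq_msum, msum_cons, size]; omega
      exact consNegConjS h1 (by omega) (by omega) (by rw [dd_neg]; omega)
        (by simp only [size_disjList_eq_msum]; omega)
    have hszT := msum_terms_le hG.size F.hσ (s := s) hk2'
    refine (negDisjListS (terms G k s e) hz (p := F.p) (fun z hz' => hG.dd_terms he hz') dL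
      (by omega) ?_).mono ?_
    · simp only [size_disjList_eq_msum]; omega
    · rw [length_terms]
      simp only [ol]
      have e1 : k + 1 ≤ F.K + 2 := by omega
      have e2 : (k + 1) * (F.ol e + 50 * (F.M + 1) ^ 2 + 7 + 35) ≤
          (F.K + 2) * (F.ol e + 50 * (F.M + 1) ^ 2 + 7 + 35) := Nat.mul_le_mul_right _ e1
      have e3 : (F.K + 2) * (F.ol e + 50 * (F.M + 1) ^ 2 + 7 + 35) + 4 ≤
          (F.K + 2) * (F.ol e + 60 * (F.M + 1) ^ 2 + 50) := by
        have : 1 ≤ (F.M + 1) ^ 2 := Nat.one_le_pow _ _ (by omega)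
        nlinarith
      omega

/-! ### One term -/

/-- **The term step** shared by monotonicity and the successor step: from `⊢ ¬Y, Y', L` and
`⊢ ¬Z, Z', L` infer `⊢ ¬(Y ∧ Z), ⋁C, L` for any list `C` containing `Y' ∧ Z'` (weaken both
into the tail `¬Y, ¬Z, L`, introduce the conjunction, fold it into `⋁C`, negate the term).
The formulas are arbitrary of level-`e` size and depth; `⋁C` is of level `e + 1`.
[Shoenfield 1967, §3.1] [folklore] -/
theorem termS {Y Z Y' Z' : PropForm ℕ} {C : List (PropForm ℕ)} {ℓ e : ℕ} (he : e + 1 ≤ F.E)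
    (sY : Y.size ≤ tsz F.σ e) (sZ : Z.size ≤ tsz F.σ e) (sY' : Y'.size ≤ tsz F.σ e)
    (sZ' : Z'.size ≤ tsz F.σ e) (dY : Y.dd ≤ F.p - 2) (dZ : Z.dd ≤ F.p - 2)
    (dY' : Y'.dd ≤ F.p - 2) (dZ' : Z'.dd ≤ F.p - 2) (hC : msum C + 1 ≤ tsz F.σ (e + 1))
    (hCd : ∀ X ∈ C, X.dd ≤ F.p) (hCl : C.length ≤ F.K + 1) (hmem : conj Y' Z' ∈ C)
    (i1 : BD F.D F.B ℓ (disjList (neg Y :: Y' :: F.L)))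
    (i2 : BD F.D F.B ℓ (disjList (neg Z :: Z' :: F.L))) :
    BD F.D F.B (2 * ℓ + 460 * (F.M + 1) ^ 3) (disjList (neg (conj Y Z) :: disjList C :: F.L)) := by
  have hB := F.hB_of_le he; have hD := F.hD; have hM := F.hM; have hp := F.hp
  have ht2 := two_mul_tsz_le F.σ e
  have hY1 := altDepthAux_le_dd_succ 1 Y
  have hZ1 := altDepthAux_le_dd_succ 1 Z
  have hY2 := altDepthAux_le_dd_succ 2 Y'
  have hZ2 := altDepthAux_le_dd_succ 2 Z'
  have dnY : (neg Y).dd ≤ F.p := by rw [dd_neg]; omega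
  have dnZ : (neg Z).dd ≤ F.p := by rw [dd_neg]; omega
  have dYZ' : (conj Y' Z').dd ≤ F.p := by rw [dd_conj]; omega
  have dC : (disjList C).dd ≤ F.p := dd_disjList_le hCd
  have hpAll : ∀ X ∈ [Y', Z', conj Y' Z', disjList C, neg Y, neg Z] ++ F.L, X.dd ≤ F.p := by
    intro X hX
    simp only [List.cons_append, List.nil_append, List.mem_cons] at hX
    rcases hX with rfl | rfl | rfl | rfl | rfl | rfl | hX
    · omega
    · omega
    · exact dYZ'
    · exact dC
    · exact dnY
    · exact dnZ
    · exact F.hLd X hX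
  have hpT : ∀ X ∈ neg Y :: neg Z :: F.L, X.dd ≤ F.p := fun X hX => hpAll X (by
    simp only [List.cons_append, List.nil_append, List.mem_cons] at hX ⊢; tauto)
  have dT : (disjList (neg Y :: neg Z :: F.L)).dd ≤ F.p := dd_disjList_le hpT
  -- (1) the hypotheses, weakened into the working tail `¬Y, ¬Z, L`
  have w1 : BD F.D F.B (ℓ + 50 * (F.M + 1) ^ 2) (disjList (Y' :: neg Y :: neg Z :: F.L)) := by
    refine subsetN (N := F.M) i1 (fun X hX => ?_) (fun X hX => hpAll X ?_) (by omega) ?_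
      (by simp; omega) (by simp; omega)
    · simp only [List.mem_cons] at hX ⊢; tauto
    · simp only [List.cons_append, List.nil_append, List.mem_cons] at hX ⊢; tauto
    · simp only [size_disjList_eq_msum, msum_cons, size]; omega
  have w2 : BD F.D F.B (ℓ + 50 * (F.M + 1) ^ 2) (disjList (Z' :: neg Y :: neg Z :: F.L)) := by
    refine subsetN (N := F.M) i2 (fun X hX => ?_) (fun X hX => hpAll X ?_) (by omega) ?_
      (by simp; omega) (by simp; omega)
    · simp only [List.mem_cons] at hX ⊢; tauto
    · simp only [List.cons_append, List.nil_append, List.mem_cons] at hX ⊢; tauto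
    · simp only [size_disjList_eq_msum, msum_cons, size]; omega
  clear i1 i2
  -- (2) the term of `⋁C`
  have w3 : BD F.D F.B (ℓ + 50 * (F.M + 1) ^ 2 + (ℓ + 50 * (F.M + 1) ^ 2) + 51)
      (disjList (conj Y' Z' :: neg Y :: neg Z :: F.L)) :=
    consConjS w1 w2 (by omega) (by omega) (by omega)
      (by simp only [size_disjList_eq_msum, msum_cons, size]; omega)
  clear w1 w2
  -- (3) fold it into `⋁C`
  have w4 : BD F.D F.B (ℓ + 50 * (F.M + 1) ^ 2 + (ℓ + 50 * (F.M + 1) ^ 2) + 51 + 300 * (F.M + 1) ^ 3)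
      (disjList (disjList C :: neg Y :: neg Z :: F.L)) := by
    refine memberFoldS (N := F.M) (p := F.p) (S := tsz F.σ (e + 1) + 2 * tsz F.σ e + msum F.L + 4)
      w3 hmem (fun X hX => ?_) (by omega) ?_ ?_ (by omega)
    · rcases List.mem_append.1 hX with hX | hX
      · exact hCd X hX
      · exact hpT X hX
    · simp only [List.length_cons]; omega
    · simp only [msum_cons, size]; omega
  clear w3
  -- (4) reorder and negate the term
  have w5 : BD F.D F.B (ℓ + 50 * (F.M + 1) ^ 2 + (ℓ + 50 * (F.M + 1) ^ 2) + 51 + 300 * (F.M + 1) ^ 3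
      + 50 * (F.M + 1) ^ 2) (disjList (neg Y :: neg Z :: disjList C :: F.L)) := by
    refine subsetN (N := F.M) w4 (fun X hX => ?_) (fun X hX => hpAll X ?_) (by omega) ?_
      (by simp; omega) (by simp; omega)
    · simp only [List.mem_cons] at hX ⊢; tauto
    · simp only [List.cons_append, List.nil_append, List.mem_cons] at hX ⊢; tauto
    · simp only [size_disjList_eq_msum, msum_cons, size]; omega
  clear w4
  have dT' : (neg (disjList (disjList C :: F.L))).dd ≤ F.p + 2 :=
    dd_neg_disjList_le (p := F.p) fun X hX => hpAll X (by
      simp only [List.cons_append, List.nil_append, List.mem_cons] at hX ⊢; tauto)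
  have w6 := consNegConjS w5 (by omega) (by omega) (by omega)
    (by simp only [size_disjList_eq_msum, msum_cons]; omega)
  refine w6.mono ?_
  have : (F.M + 1) ^ 2 ≤ (F.M + 1) ^ 3 := Nat.pow_le_pow_right (by omega) (by omega)
  have h8 : (2 : ℕ) ^ 3 ≤ (F.M + 1) ^ 3 := Nat.pow_le_pow_left (by omega) 3
  norm_num at h8
  omega

/-! ### Monotonicity -/

/-- **Monotonicity of threshold formulas**: if `⊢ ¬G l, G' l, L` (that is, `G l → G' l`) for
every input of the segment, then `⊢ ¬ thr G k s e, thr G' k s e, L` for every `k`: each term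
`thr G a Y ∧ thr G (k-a) Z` implies the corresponding term of `thr G' k`. [folklore] -/
theorem monoS {G G' : ℕ → PropForm ℕ} (hG : F.Good G) (hG' : F.Good G') {m : ℕ} :
    ∀ e, e ≤ F.E → ∀ s,
      (∀ l, s ≤ l → l < s + 2 ^ e → BD F.D F.B m (disjList (neg (G l) :: G' l :: F.L))) →
      ∀ k, BD F.D F.B (F.ml m e) (disjList (neg (thr G k s e) :: thr G' k s e :: F.L)) := by
  have hB := F.hB; have hD := F.hD; have hM := F.hM; have hp := F.hp
  have dL : (disjList F.L).dd ≤ F.p := dd_disjList_le F.hLd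
  -- the generic `⊢ ¬⊥, ⊥, L` and `⊢ ¬⊤, ⊤, L`
  have hbot : BD F.D F.B (8 + 50 * (F.M + 1) ^ 2)
      (disjList (neg (const false) :: const false :: F.L)) := by
    refine negBotMemS (N := F.M) List.mem_cons_self (p := F.p) (fun X hX => ?_) (by omega)
      (by simp; omega) (by simp only [msum_cons, size]; omega)
    simp only [List.mem_cons] at hX
    rcases hX with rfl | rfl | hX
    · exact F.dd_negBot_le_p
    · simp
    · exact F.hLd X hX
  have htop : BD F.D F.B (8 + 50 * (F.M + 1) ^ 2)
      (disjList (neg (const true) :: const true :: F.L)) := by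
    refine topMemS (N := F.M) (List.mem_cons_of_mem _ List.mem_cons_self) (p := F.p)
      (fun X hX => ?_) (by omega) (by simp; omega) (by simp only [msum_cons, size]; omega)
    simp only [List.mem_cons] at hX
    rcases hX with rfl | rfl | hX
    · simp; omega
    · simp
    · exact F.hLd X hX
  intro e
  induction e with
  | zero =>
    intro _ s h1 k
    rcases k with _ | _ | k
    · simpa only [thr_zero_leaf] using htop.mono (by simp [ml])
    · simpa only [zero_add, thr_one_leaf] using (h1 s le_rfl (by simp)).mono (by simp [ml]; omega)
    · rw [thr_leaf_of_two_le (by omega), thr_leaf_of_two_le (by omega)]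
      exact hbot.mono (by simp [ml])
  | succ e ih =>
    intro he s h1 k
    have he' : e ≤ F.E := by omega
    have hKe : 2 ^ (e + 1) ≤ F.K := F.pow_le_K he
    have h2e : 2 ^ (e + 1) = 2 ^ e + 2 ^ e := by rw [pow_succ]; ring
    by_cases hk : 2 ^ (e + 1) < k
    · rw [thr_succ_of_lt hk, thr_succ_of_lt hk]
      exact hbot.mono (by have := base_le_ml (F := F) m (e + 1); omega)
    have hk' : k ≤ 2 ^ (e + 1) := by omega
    have htE := tsz_mono F.σ he
    -- the two induction hypotheses
    have ihY := ih he' s (fun l hl hl' => h1 l hl (by omega))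
    have ihZ := ih he' (s + 2 ^ e) (fun l hl hl' => h1 l (by omega) (by omega))
    clear ih h1
    rw [thr_succ_of_le hk' s, thr_succ_of_le hk' s]
    have hszT := msum_terms_le hG.size F.hσ (s := s) hk'
    have hszT' := msum_terms_le hG'.size F.hσ (s := s) hk'
    have dT' : (disjList (terms G' k s e)).dd ≤ F.p - 2 := by
      rw [← thr_succ_of_le hk' s]; exact hG'.dd_thr he k s
    -- each term of `thr G k` implies `thr G' k`
    have hz : ∀ z ∈ terms G k s e, BD F.D F.B (2 * F.ml m e + 460 * (F.M + 1) ^ 3)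
        (disjList (neg z :: disjList (terms G' k s e) :: F.L)) := by
      intro z hz
      obtain ⟨a, ha, rfl⟩ := mem_terms_iff.1 hz
      exact F.termS he (hG.size_thr e _ _) (hG.size_thr e _ _) (hG'.size_thr e _ _)
        (hG'.size_thr e _ _) (hG.dd_thr he' _ _) (hG.dd_thr he' _ _) (hG'.dd_thr he' _ _)
        (hG'.dd_thr he' _ _) hszT' (fun X hX => hG'.dd_terms he hX) (by simp; omega)
        (conj_mem_terms ha) (ihY a) (ihZ (k - a))
    refine (negDisjListS (terms G k s e) hz (p := F.p) (fun z hz' => hG.dd_terms he hz')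
      (dd_disjList_le (L := disjList (terms G' k s e) :: F.L) fun X hX => ?_) (by omega) ?_).mono ?_
    · rcases List.mem_cons.1 hX with rfl | hX
      · omega
      · exact F.hLd X hX
    · simp only [size_disjList_eq_msum, msum_cons]; omega
    · rw [length_terms]
      simp only [ml]
      have e1 : k + 1 ≤ F.K + 1 := by omega
      have e2 : (k + 1) * (2 * F.ml m e + 460 * (F.M + 1) ^ 3 + 35) ≤
          (F.K + 1) * (2 * F.ml m e + 460 * (F.M + 1) ^ 3 + 35) := Nat.mul_le_mul_right _ e1
      have e3 : 1 ≤ (F.M + 1) ^ 3 := Nat.one_le_pow _ _ (by omega)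
      have e4 : (F.K + 1) * (2 * F.ml m e + 460 * (F.M + 1) ^ 3 + 35) + 4 ≤
          (F.K + 2) * (2 * F.ml m e + 500 * (F.M + 1) ^ 3) := by nlinarith
      omega

end Frame

end ThrCount

end Literature.Computability.MetaComplexity
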